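import Mathlib
import HarnessLib

/-!
# Sign of a determinant from a certified non-singularity test (`JiaSverakCAP.PreconditionedDetSign`)

HONEST FRAMING (audit cell `pub-nsjs`, papers/NavierStokesRegularity/ns-jia-sverak; seat B gen 15). Finite-dimensional real
linear algebra only; asserts nothing about Navier–Stokes. This is the kernel form of the LOGIC of the cell's determinant-sign
step "(iv)" (DET2D-HYPOTHESES.md H5 TEST PD; LEMMAS-v13 L4; the two implementations of record `det2pd_cert.py` (#1) and
`det2pd_certB.py` (#2)): the engines hold an exact rational midpoint matrix `Mt ≈ M(z)`, a certified bound `η ≥ ‖Mt − M(z)‖₂`, and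
EITHER (#1) an approximate inverse `P` with `κ := ‖1 − P Mt‖_F + ‖P‖_F η < 1`, OR (#2) an exact `LDLᵀ` showing
`Mtᵀ Mt − η² 1` positive definite (`σ_min(Mt) > η`); they then report `sign det M(z) = sign det Mt`. Here:

* `det_ne_zero_of_norm_one_sub_lt` — `‖1 − B‖₂ < 1 ⇒ det B ≠ 0` (a kernel vector `v` would satisfy `v = (1 − B) v`);
* **`det_sign_of_segment`** — if every matrix on the segment `M_t = M₀ + t (M₁ − M₀)`, `t ∈ [0, 1]`, is non-singular then
  `det M₀`, `det M₁` are non-zero with the same sign (continuity of `det`, intermediate value theorem);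
* **`det_pos_iff_of_precond`** — (#1) `‖1 − P M₀‖₂ < 1 ∧ ‖1 − P M₁‖₂ < 1 ⇒` same sign (the segment stays in the test region by
  convexity of the norm ball); **`det_pos_iff_of_norm_test`** — the packaged form `θ ≥ ‖1 − P Mt‖₂`, `π ≥ ‖P‖₂`, `η ≥ ‖Mt − M‖₂`,
  `θ + π η < 1` (the cell's `κ_pd`, with Frobenius data admissible by `l2_opNorm_le_sqrt_sum_sq`); `det_pos_iff_of_frobenius_test`
  — the same from entrywise radii;
* **`det_segment_ne_zero_of_posDef`**, **`det_pos_iff_of_posDef_test`** — (#2) `Mtᵀ Mt − η² 1` positive definite and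
  `‖Mt − M‖₂ ≤ η ⇒` every `Mt + t (M − Mt)` is non-singular, hence same sign.

The operator (`ℓ² → ℓ²`) norm on `Matrix ι ι ℝ` is Mathlib's scoped instance `Matrix.Norms.L2Operator`; its topology is by
construction the product topology, so `Continuous.matrix_det` applies. References: (#1) is the standard approximate-inverse
regularity test (`‖I − RA‖ < 1 ⇒ A` non-singular), cf. S. M. Rump, *Verification methods: rigorous results using floating-point
arithmetic*, Acta Numerica 19 (2010) §10 [Rump2010Verification]; (#2) is the singular-value perturbation bound. Everything below is
proved from first principles [folklore].
-/

open scoped BigOperators Matrix Matrix.Norms.L2Operator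
open Set

noncomputable section

namespace Summit.NavierStokesRegularity.JiaSverakCAP

namespace PreconditionedDetSign

variable {ι : Type*} [Fintype ι] [DecidableEq ι]

/-! ### Euclidean bookkeeping -/

omit [DecidableEq ι] in
/-- `‖v‖₂² = v ⬝ᵥ v` for a real vector read in `EuclideanSpace`. [folklore] -/
lemma norm_sq_eq_dotProduct (u : ι → ℝ) : ‖(EuclideanSpace.equiv ι ℝ).symm u‖ ^ 2 = u ⬝ᵥ u := by
  rw [EuclideanSpace.norm_sq_eq]
  change ∑ i, ‖u i‖ ^ 2 = _
  simp [dotProduct, pow_two]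

/-- The operator-norm bound on `A *ᵥ v` in Euclidean norms. [folklore] -/
lemma norm_mulVec_le (A : Matrix ι ι ℝ) (v : ι → ℝ) :
    ‖(EuclideanSpace.equiv ι ℝ).symm (A *ᵥ v)‖ ≤ ‖A‖ * ‖(EuclideanSpace.equiv ι ℝ).symm v‖ := by
  have h := Matrix.l2_opNorm_mulVec A ((EuclideanSpace.equiv ι ℝ).symm v)
  exact h

/-! ### Non-singularity tests -/

/-- `‖1 − B‖₂ < 1` forces `det B ≠ 0`: a kernel vector `v ≠ 0` of `B` would be fixed by `1 − B`, whence
`‖v‖ ≤ ‖1 − B‖ ‖v‖ < ‖v‖`. [folklore] -/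
theorem det_ne_zero_of_norm_one_sub_lt (B : Matrix ι ι ℝ) (h : ‖(1 : Matrix ι ι ℝ) - B‖ < 1) : B.det ≠ 0 := by
  intro hdet
  obtain ⟨v, hv0, hv⟩ := Matrix.exists_mulVec_eq_zero_iff.mpr hdet
  set x : EuclideanSpace ℝ ι := (EuclideanSpace.equiv ι ℝ).symm v with hx
  have hx0 : x ≠ 0 := by
    intro h0
    apply hv0
    have : (⇑x : ι → ℝ) = v := rfl
    rw [← this, h0]
    rfl
  have hfix : ((1 : Matrix ι ι ℝ) - B) *ᵥ v = v := by
    rw [Matrix.sub_mulVec, Matrix.one_mulVec, hv, sub_zero]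
  have hle := norm_mulVec_le ((1 : Matrix ι ι ℝ) - B) v
  rw [hfix, ← hx] at hle
  have hxpos : 0 < ‖x‖ := norm_pos_iff.mpr hx0
  nlinarith

/-- (#2) If `Mtᵀ Mt − η² 1` is positive definite (`σ_min(Mt) > η`) and `‖Mt − M‖₂ ≤ η`, then every matrix on the segment from
`Mt` to `M` is non-singular: a kernel vector `v` of `Mt + t (M − Mt)` gives `‖Mt v‖ = t ‖(Mt − M) v‖ ≤ η ‖v‖`, contradicting
`vᵀ (Mtᵀ Mt − η²) v > 0`. [folklore] -/
theorem det_segment_ne_zero_of_posDef (Mt M : Matrix ι ι ℝ) (η : ℝ)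
    (hpos : (Mtᵀ * Mt - η ^ 2 • (1 : Matrix ι ι ℝ)).PosDef) (hη : ‖Mt - M‖ ≤ η) :
    ∀ t ∈ Icc (0 : ℝ) 1, (Mt + t • (M - Mt)).det ≠ 0 := by
  intro t ht hdet
  obtain ⟨v, hv0, hv⟩ := Matrix.exists_mulVec_eq_zero_iff.mpr hdet
  have hη0 : 0 ≤ η := (norm_nonneg _).trans hη
  -- `Mt v = t • (Mt − M) v`
  have key : Mt *ᵥ v = t • ((Mt - M) *ᵥ v) := by
    rw [Matrix.add_mulVec, Matrix.smul_mulVec, Matrix.sub_mulVec, smul_sub] at hv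
    rw [Matrix.sub_mulVec, smul_sub]
    have h' : Mt *ᵥ v - (t • Mt *ᵥ v - t • M *ᵥ v) = Mt *ᵥ v + (t • M *ᵥ v - t • Mt *ᵥ v) := by abel
    exact sub_eq_zero.mp (h'.trans hv)
  -- Euclidean norms
  set x : EuclideanSpace ℝ ι := (EuclideanSpace.equiv ι ℝ).symm v with hx
  have hd : ‖(EuclideanSpace.equiv ι ℝ).symm ((Mt - M) *ᵥ v)‖ ≤ η * ‖x‖ :=
    (norm_mulVec_le (Mt - M) v).trans (mul_le_mul_of_nonneg_right hη (norm_nonneg _))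
  have hy : ‖(EuclideanSpace.equiv ι ℝ).symm (Mt *ᵥ v)‖ ≤ η * ‖x‖ := by
    rw [key, map_smul, norm_smul, Real.norm_of_nonneg ht.1]
    calc t * ‖(EuclideanSpace.equiv ι ℝ).symm ((Mt - M) *ᵥ v)‖ ≤ 1 * (η * ‖x‖) :=
          mul_le_mul ht.2 hd (norm_nonneg _) zero_le_one
      _ = η * ‖x‖ := one_mul _
  have hsq : (Mt *ᵥ v) ⬝ᵥ (Mt *ᵥ v) ≤ η ^ 2 * (v ⬝ᵥ v) := by
    rw [← norm_sq_eq_dotProduct, ← norm_sq_eq_dotProduct, ← hx, ← mul_pow]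
    exact pow_le_pow_left₀ (norm_nonneg _) hy 2
  -- the quadratic form
  have hq := hpos.dotProduct_mulVec_pos hv0
  rw [star_trivial, Matrix.sub_mulVec, dotProduct_sub, Matrix.smul_mulVec, Matrix.one_mulVec, dotProduct_smul,
    smul_eq_mul, ← Matrix.mulVec_mulVec, Matrix.dotProduct_mulVec, Matrix.vecMul_transpose] at hq
  linarith

/-! ### Sign along a non-singular segment -/

/-- A continuous real function on `[0, 1]` with values of opposite strict signs at the end points vanishes somewhere
in `[0, 1]`. [folklore] -/
lemma exists_Icc_eq_zero {f : ℝ → ℝ} (hf : ContinuousOn f (Icc 0 1)) (h : f 0 * f 1 < 0) :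
    ∃ t ∈ Icc (0 : ℝ) 1, f t = 0 := by
  rcases mul_neg_iff.mp h with ⟨h0, h1⟩ | ⟨h0, h1⟩
  · exact intermediate_value_Icc' zero_le_one hf ⟨h1.le, h0.le⟩
  · exact intermediate_value_Icc zero_le_one hf ⟨h0.le, h1.le⟩

/-- **Sign along a non-singular segment.** If `det (M₀ + t (M₁ − M₀)) ≠ 0` for all `t ∈ [0, 1]` then `det M₀`, `det M₁` are
non-zero and have the same sign. [folklore] -/
theorem det_sign_of_segment (M₀ M₁ : Matrix ι ι ℝ) (hnz : ∀ t ∈ Icc (0 : ℝ) 1, (M₀ + t • (M₁ - M₀)).det ≠ 0) :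
    M₀.det ≠ 0 ∧ M₁.det ≠ 0 ∧ (0 < M₀.det ↔ 0 < M₁.det) ∧ (M₀.det < 0 ↔ M₁.det < 0) := by
  set seg : ℝ → Matrix ι ι ℝ := fun t => M₀ + t • (M₁ - M₀) with hseg
  have hseg0 : seg 0 = M₀ := by simp [hseg]
  have hseg1 : seg 1 = M₁ := by simp [hseg]
  have hcont : Continuous fun t => (seg t).det :=
    (continuous_const.add (continuous_id.smul continuous_const)).matrix_det
  have hd0 : M₀.det ≠ 0 := hseg0 ▸ hnz 0 ⟨le_rfl, zero_le_one⟩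
  have hd1 : M₁.det ≠ 0 := hseg1 ▸ hnz 1 ⟨zero_le_one, le_rfl⟩
  -- no sign change, else a zero on the segment
  have hns : ¬ (M₀.det * M₁.det < 0) := by
    intro hmul
    rw [← hseg0, ← hseg1] at hmul
    obtain ⟨t, ht, ht0⟩ := exists_Icc_eq_zero hcont.continuousOn hmul
    exact hnz t ht ht0
  refine ⟨hd0, hd1, ?_, ?_⟩
  · rcases lt_or_gt_of_ne hd0 with h0 | h0 <;> rcases lt_or_gt_of_ne hd1 with h1 | h1
    · exact iff_of_false (not_lt.mpr h0.le) (not_lt.mpr h1.le)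
    · exact absurd (mul_neg_of_neg_of_pos h0 h1) hns
    · exact absurd (mul_neg_of_pos_of_neg h0 h1) hns
    · exact iff_of_true h0 h1
  · rcases lt_or_gt_of_ne hd0 with h0 | h0 <;> rcases lt_or_gt_of_ne hd1 with h1 | h1
    · exact iff_of_true h0 h1
    · exact absurd (mul_neg_of_neg_of_pos h0 h1) hns
    · exact absurd (mul_neg_of_pos_of_neg h0 h1) hns
    · exact iff_of_false (not_lt.mpr h0.le) (not_lt.mpr h1.le)

/-! ### Test #1: preconditioned residual -/

/-- **(#1) Sign of a determinant along a preconditioned segment.** If one preconditioner `P` gives `‖1 − P M₀‖₂ < 1` and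
`‖1 − P M₁‖₂ < 1`, then both determinants are non-zero and have the same sign. [folklore] -/
theorem det_pos_iff_of_precond (P M₀ M₁ : Matrix ι ι ℝ) (h₀ : ‖(1 : Matrix ι ι ℝ) - P * M₀‖ < 1)
    (h₁ : ‖(1 : Matrix ι ι ℝ) - P * M₁‖ < 1) :
    M₀.det ≠ 0 ∧ M₁.det ≠ 0 ∧ (0 < M₀.det ↔ 0 < M₁.det) ∧ (M₀.det < 0 ↔ M₁.det < 0) := by
  refine det_sign_of_segment M₀ M₁ fun t ht hdet => ?_
  have hsplit : (1 : Matrix ι ι ℝ) - P * (M₀ + t • (M₁ - M₀)) =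
      (1 - t) • ((1 : Matrix ι ι ℝ) - P * M₀) + t • (1 - P * M₁) := by
    simp only [Matrix.mul_add, Matrix.mul_smul, Matrix.mul_sub, smul_sub, sub_smul, one_smul]
    abel
  have hnorm : ‖(1 : Matrix ι ι ℝ) - P * (M₀ + t • (M₁ - M₀))‖ < 1 := by
    rw [hsplit]
    calc ‖(1 - t) • ((1 : Matrix ι ι ℝ) - P * M₀) + t • (1 - P * M₁)‖
        ≤ ‖(1 - t) • ((1 : Matrix ι ι ℝ) - P * M₀)‖ + ‖t • ((1 : Matrix ι ι ℝ) - P * M₁)‖ := norm_add_le _ _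
      _ = (1 - t) * ‖(1 : Matrix ι ι ℝ) - P * M₀‖ + t * ‖(1 : Matrix ι ι ℝ) - P * M₁‖ := by
        rw [norm_smul, norm_smul, Real.norm_of_nonneg (sub_nonneg.2 ht.2), Real.norm_of_nonneg ht.1]
      _ < 1 := by
        have hB : t * ‖(1 : Matrix ι ι ℝ) - P * M₁‖ ≤ t * 1 := mul_le_mul_of_nonneg_left h₁.le ht.1
        rcases eq_or_lt_of_le ht.2 with rfl | htlt
        · norm_num; exact h₁
        · have hA : (1 - t) * ‖(1 : Matrix ι ι ℝ) - P * M₀‖ < (1 - t) * 1 :=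
            mul_lt_mul_of_pos_left h₀ (sub_pos.2 htlt)
          linarith
  have hP := det_ne_zero_of_norm_one_sub_lt (P * (M₀ + t • (M₁ - M₀))) hnorm
  rw [Matrix.det_mul, hdet, mul_zero] at hP
  exact hP rfl

/-- **Operator norm ≤ Frobenius norm**: `‖A‖₂ ≤ (Σ_ij A_ij²)^{1/2}` (row-wise Cauchy–Schwarz). [folklore] -/
theorem l2_opNorm_le_sqrt_sum_sq (A : Matrix ι ι ℝ) : ‖A‖ ≤ Real.sqrt (∑ i, ∑ j, A i j ^ 2) := by
  set F : ℝ := ∑ i, ∑ j, A i j ^ 2 with hF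
  have hF0 : 0 ≤ F := Finset.sum_nonneg fun i _ => Finset.sum_nonneg fun j _ => sq_nonneg _
  rw [Matrix.cstar_norm_def]
  refine ContinuousLinearMap.opNorm_le_bound _ (Real.sqrt_nonneg F) fun x => ?_
  rw [← Real.sqrt_sq (norm_nonneg (Matrix.toEuclideanCLM (n := ι) (𝕜 := ℝ) A x)),
    ← Real.sqrt_sq (norm_nonneg x), ← Real.sqrt_mul hF0]
  refine Real.sqrt_le_sqrt ?_
  rw [EuclideanSpace.norm_sq_eq, EuclideanSpace.norm_sq_eq, hF, Finset.sum_mul]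
  refine Finset.sum_le_sum fun i _ => ?_
  have hi : (Matrix.toEuclideanCLM (n := ι) (𝕜 := ℝ) A x) i = ∑ j, A i j * x j := by
    rw [Matrix.ofLp_toEuclideanCLM]
    rfl
  rw [hi, Real.norm_eq_abs, sq_abs]
  have hx : ∑ j, ‖x j‖ ^ 2 = ∑ j, x j ^ 2 := Finset.sum_congr rfl fun j _ => by rw [Real.norm_eq_abs, sq_abs]
  rw [hx]
  exact Finset.sum_mul_sq_le_sq_mul_sq _ _ _

/-- Entrywise radii bound the operator norm of the difference: `|M_ij − Mt_ij| ≤ ρ_ij ⇒ ‖Mt − M‖₂ ≤ ‖ρ‖_F`. [folklore] -/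
theorem l2_opNorm_sub_le_of_abs_le (M Mt ρ : Matrix ι ι ℝ) (hρ : ∀ i j, |M i j - Mt i j| ≤ ρ i j) :
    ‖Mt - M‖ ≤ Real.sqrt (∑ i, ∑ j, ρ i j ^ 2) := by
  refine (l2_opNorm_le_sqrt_sum_sq (Mt - M)).trans (Real.sqrt_le_sqrt ?_)
  refine Finset.sum_le_sum fun i _ => Finset.sum_le_sum fun j _ => ?_
  rw [Matrix.sub_apply, ← sq_abs, abs_sub_comm]
  exact pow_le_pow_left₀ (abs_nonneg _) (hρ i j) 2

/-- Residual splitting: `‖1 − P M‖ ≤ ‖1 − P Mt‖ + ‖P‖ ‖Mt − M‖`. [folklore] -/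
theorem norm_one_sub_mul_le (P Mt M : Matrix ι ι ℝ) :
    ‖(1 : Matrix ι ι ℝ) - P * M‖ ≤ ‖(1 : Matrix ι ι ℝ) - P * Mt‖ + ‖P‖ * ‖Mt - M‖ := by
  have h : (1 : Matrix ι ι ℝ) - P * M = ((1 : Matrix ι ι ℝ) - P * Mt) + P * (Mt - M) := by
    rw [Matrix.mul_sub]; abel
  rw [h]
  exact (norm_add_le _ _).trans (by gcongr; exact Matrix.l2_opNorm_mul _ _)

/-- **(#1) The determinant-sign test, operator-norm form** (the shape of the cell's `κ_pd < 1` check: `θ ≥ ‖1 − P Mt‖₂`,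
`π ≥ ‖P‖₂`, `η ≥ ‖Mt − M‖₂` and `θ + π η < 1`; `det2pd_cert.py` uses `θ = ‖1 − P Mt‖_F`, `π = ‖P‖_F`, admissible by
`l2_opNorm_le_sqrt_sum_sq`). Output: `det M ≠ 0` and `det M` has the sign of `det Mt`. [folklore] -/
theorem det_pos_iff_of_norm_test (P Mt M : Matrix ι ι ℝ) (θ π η : ℝ) (hθ : ‖(1 : Matrix ι ι ℝ) - P * Mt‖ ≤ θ)
    (hπ : ‖P‖ ≤ π) (hη : ‖Mt - M‖ ≤ η) (hκ : θ + π * η < 1) :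
    M.det ≠ 0 ∧ (0 < M.det ↔ 0 < Mt.det) ∧ (M.det < 0 ↔ Mt.det < 0) := by
  have hπ0 : 0 ≤ π := (norm_nonneg _).trans hπ
  have hη0 : 0 ≤ η := (norm_nonneg _).trans hη
  have h₀ : ‖(1 : Matrix ι ι ℝ) - P * Mt‖ < 1 := lt_of_le_of_lt hθ (by nlinarith)
  have h₁ : ‖(1 : Matrix ι ι ℝ) - P * M‖ < 1 := by
    refine lt_of_le_of_lt (norm_one_sub_mul_le P Mt M) ?_
    calc ‖(1 : Matrix ι ι ℝ) - P * Mt‖ + ‖P‖ * ‖Mt - M‖ ≤ θ + π * η :=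
          add_le_add hθ (mul_le_mul hπ hη (norm_nonneg _) hπ0)
      _ < 1 := hκ
  obtain ⟨_, hdM, hiff, hiff'⟩ := det_pos_iff_of_precond P Mt M h₀ h₁
  exact ⟨hdM, hiff.symm, hiff'.symm⟩

/-- **(#1) The determinant-sign test, Frobenius / entrywise form.** Inputs: a midpoint matrix `Mt`, a preconditioner `P`,
entrywise radii `ρ` enclosing the true matrix `M`, and real bounds `θ ≥ ‖1 − P Mt‖_F`, `π ≥ ‖P‖_F`, `r ≥ ‖ρ‖_F` with
`θ + π r < 1`. Output: `det M ≠ 0` and `det M` has the sign of `det Mt`. [folklore] -/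
theorem det_pos_iff_of_frobenius_test (P Mt M ρ : Matrix ι ι ℝ) (θ π r : ℝ)
    (hθ : Real.sqrt (∑ i, ∑ j, ((1 : Matrix ι ι ℝ) - P * Mt) i j ^ 2) ≤ θ)
    (hπ : Real.sqrt (∑ i, ∑ j, P i j ^ 2) ≤ π) (hρ : ∀ i j, |M i j - Mt i j| ≤ ρ i j)
    (hr : Real.sqrt (∑ i, ∑ j, ρ i j ^ 2) ≤ r) (hκ : θ + π * r < 1) :
    M.det ≠ 0 ∧ (0 < M.det ↔ 0 < Mt.det) ∧ (M.det < 0 ↔ Mt.det < 0) :=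
  det_pos_iff_of_norm_test P Mt M θ π r ((l2_opNorm_le_sqrt_sum_sq _).trans hθ)
    ((l2_opNorm_le_sqrt_sum_sq P).trans hπ) ((l2_opNorm_sub_le_of_abs_le M Mt ρ hρ).trans hr) hκ

/-! ### Test #2: least singular value -/

/-- **(#2) The determinant-sign test, `σ_min` form**: `Mtᵀ Mt − η² 1` positive definite and `‖Mt − M‖₂ ≤ η` give `det M ≠ 0`
with the sign of `det Mt`. [folklore] -/
theorem det_pos_iff_of_posDef_test (Mt M : Matrix ι ι ℝ) (η : ℝ)
    (hpos : (Mtᵀ * Mt - η ^ 2 • (1 : Matrix ι ι ℝ)).PosDef) (hη : ‖Mt - M‖ ≤ η) :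
    M.det ≠ 0 ∧ (0 < M.det ↔ 0 < Mt.det) ∧ (M.det < 0 ↔ Mt.det < 0) := by
  obtain ⟨_, hdM, hiff, hiff'⟩ := det_sign_of_segment Mt M (det_segment_ne_zero_of_posDef Mt M η hpos hη)
  exact ⟨hdM, hiff.symm, hiff'.symm⟩

end PreconditionedDetSign

end Summit.NavierStokesRegularity.JiaSverakCAP

end
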